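import Mathlib.Topology.Algebra.Category.ProfiniteGrp.Basic
import Mathlib.GroupTheory.Perm.Fin
import Literature.AnabelianGeometry.AbsoluteAnabelian.AbsTopII.InertiaGroups
import Literature.AnabelianGeometry.AbsoluteAnabelian.AbsTopII.InertiaDecompositionProofs
import Literature.AnabelianGeometry.AbsoluteAnabelian.AbsTopII.Prop13ConjugacyScope

/-!
# [AbsTopII] Prop 1.3 (v) (middle clause) and (x) as typed: the universal closures of the schemata —
# kernel verdicts (FACT-LIST F-0300, F-0301)

S. Mochizuki, *Topics in Absolute Anabelian Geometry II* [AbsTopII] (bib `MochizukiAbsTopII2013`;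
locators = PDF pages of the kurims manuscript `paper:url-585b8d0ad0d9`), §1, Proposition 1.3 (v),
(x) p. 12.  PROOF-ONLY companion of `AbsTopII/InertiaGroups.lean` (abc-iut cell, F fact-proving
wave, seat abc-iut-f-070); no notion is declared, nothing is restated.

Both rows are SCHEMATA: abc-iut-L4-t6's `DPSCIndexData.Prop_1_3_v'` and `DPSCIndexData.Prop_1_3_x`
are PREDICATES on ABSTRACT DPSC data `X : DPSCIndexData` (a profinite group `Π_H` with normal
subgroups `Π_𝔾 ⊆ Π_I`, vertex / node / cusp labels with chosen subgroups; the REAL definitions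
`D_v := N_{Π_H}(Π_v)`, `I_v := Z_{Π_I}(Π_v)` of Def 1.2 (ii)); the module docstring of the trunk
file says so ("it holds for data arising from a stable log curve over a log point; no model-relative
comparison is asserted").  Kernel verdict (FACT-LIST rule R5: a universal closure of a schema row is
not a fact):

* `not_forall_prop_1_3_v'` (F-0300) — the UNIVERSAL CLOSURE `∀ X, X.Prop_1_3_v'` is FALSE: over the
  symmetric group `Π_H = 𝔖₃` (finite, discrete, hence profinite) with `Π_𝔾 = 1`, `Π_I = Π_H`, one
  vertex `v` and `Π_v = 1`, one has `D_v = I_v = Π_I = 𝔖₃`, so the clause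
  "`D_v ∩ Π_I = Z_{Π_I}(I_v)`" reads `𝔖₃ = Z(𝔖₃) = 1` — false ((1 2) and (2 3) do not commute).  The
  printed inputs that EXCLUDE such data are exactly the hypotheses of the tree's conditional proof
  `DPSCIndexData.prop_1_3_v'_of_prop_1_3_iii'` (`InertiaDecompositionProofs.lean`: Prop 1.3 (iii)
  `I_v ≅ Ẑ^Σ` abelian, `D_v ∩ Π_I = I_v × Π_v`; graphicity; [CombGC] Prop 1.2 (i)(ii); "(iv) at open
  subgroups") — the form in which the row is consumable.
* `exists_prop_1_3_v'` — the schema is satisfiable (trivially: `Π_H = 1`); so the row is a genuine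
  HYPOTHESIS on the data, neither a theorem nor absurd.
* `not_forall_prop_1_3_x` (F-0301) — the UNIVERSAL CLOSURE `∀ X, X.Prop_1_3_x` is FALSE for a reason
  independent of abc-iut-L4-t6's own conjugacy-scope certificate `not_prop_1_3_x_of_cusps_moved`
  (`Prop13ConjugacyScope.lean`): the field `LogPointData.kind` ("the image of `τ_S` in `X`") is a
  FREE LABEL not tied to the group-theoretic datum `τ_I(I)`; over `Π_H = 1` with two vertices
  `v₀ ≠ v₁` and a log point labelled "smooth point of `v₁`", the clause "`τ_I(I) = I_{v₀}` [some
  conjugate] iff the image of `τ_S` is a non-nodal point of `v₀`" has a true left side (`1 = 1`)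
  and a false right side.
* `exists_prop_1_3_x` — the schema is satisfiable (`Π_H = 1`, one vertex).
* `prop_1_3_v'_schema_verdict`, `prop_1_3_x_schema_verdict` — both conjuncts in one statement.

HONEST FRAMING: statements about the cell's own typings of a refereed pre-IUT proposition as
predicates on abstract data — the printed Prop 1.3 concerns the data of a stable log curve and is
neither refuted nor proved here; nothing here bears on [IUTchIII] Cor 3.12 or takes a side;
typed ≠ proved.
-/

open scoped Pointwise

namespace Literature.AnabelianGeometry.AbsoluteAnabelian.AbsTopII.DPSCIndexData

/-! ## F-0300: Prop 1.3 (v), middle clause (`Prop_1_3_v'`) -/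

/-- **F-0300, universal closure REFUTED.**  `DPSCIndexData.Prop_1_3_v'` does NOT hold for all
abstract DPSC index data: over `Π_H = 𝔖₃` (discrete), `Π_𝔾 = 1`, `Π_I = Π_H`, one vertex with
`Π_v = 1` (so `D_v = I_v = 𝔖₃`), the clause `D_v ∩ Π_I = Z_{Π_I}(I_v)` fails: the transpositions
`(0 1)`, `(1 2)` do not commute.  The excluded data violate Prop 1.3 (iii) (`I_v ≅ Ẑ^Σ` is abelian),
an input of the tree's conditional proof `prop_1_3_v'_of_prop_1_3_iii'`.
[cite: MochizukiAbsTopII2013, Prop 1.3 (v) p.12] -/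
theorem not_forall_prop_1_3_v' :
    ¬ ∀ X : DPSCIndexData.{0},
      Literature.AnabelianGeometry.AbsoluteAnabelian.AbsTopII.DPSCIndexData.Prop_1_3_v' X := by
  intro h
  -- the symmetric group `𝔖₃` with the discrete topology: a finite, hence profinite, group
  letI : TopologicalSpace (Equiv.Perm (Fin 3)) := ⊥
  haveI : DiscreteTopology (Equiv.Perm (Fin 3)) := ⟨rfl⟩
  let P : ProfiniteGrp.{0} := ProfiniteGrp.of (Equiv.Perm (Fin 3))
  -- degenerate DPSC index data: `Π_𝔾 = 1`, `Π_I = Π_H = 𝔖₃`, one vertex, `Π_v = 1`, no edges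
  let X : DPSCIndexData.{0} :=
    { PiH := P, PiG := ⊥, normal_PiG := inferInstance, isClosed_PiG := isClosed_discrete _,
      PiI := ⊤, PiG_le_PiI := bot_le, normal_PiI := ⟨fun _ _ _ => Subgroup.mem_top _⟩,
      Vert := PUnit, Node := PEmpty, Cusp := PEmpty,
      vertSub := fun _ => ⊥, vertSub_le := fun _ => le_rfl,
      nodeSub := fun e => e.elim, nodeSub_le := fun e => e.elim,
      cuspSub := fun e => e.elim, cuspSub_le := fun e => e.elim,
      nodeAbuts := fun e _ => e.elim, cuspVert := fun e => e.elim,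
      Sigma := {2},
      sigma_prime := ⟨Set.singleton_nonempty 2, fun p hp => by
        rw [Set.mem_singleton_iff.mp hp]; exact Nat.prime_two⟩,
      sigmaIndex := fun e => e.elim, sigmaIndex_isSigmaInteger := fun e => e.elim }
  obtain ⟨-, -, h3, -⟩ := h X PUnit.unit
  -- `D_v = N_{Π_H}(1) = Π_H` and `I_v = Z_{Π_H}(1) ∩ Π_I = Π_H`
  have hDv : X.Dv PUnit.unit = ⊤ := Subgroup.normalizer_eq_top (⊥ : Subgroup P)
  have hIv : X.Iv PUnit.unit = ⊤ := by
    show Subgroup.centralizer ((⊥ : Subgroup P) : Set P) ⊓ ⊤ = ⊤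
    rw [inf_top_eq, Subgroup.centralizer_eq_top_iff_subset, Subgroup.coe_bot,
      Set.singleton_subset_iff]
    exact Subgroup.one_mem _
  -- the transpositions `(0 1)`, `(1 2)` as elements of `Π_I`
  let a : ↥X.PiI := ⟨(Equiv.swap (0 : Fin 3) 1 : Equiv.Perm (Fin 3)), Subgroup.mem_top _⟩
  let b : ↥X.PiI := ⟨(Equiv.swap (1 : Fin 3) 2 : Equiv.Perm (Fin 3)), Subgroup.mem_top _⟩
  have ha : a ∈ (X.Dv PUnit.unit ⊓ X.PiI).subgroupOf X.PiI := by
    rw [Subgroup.mem_subgroupOf, hDv]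
    exact Subgroup.mem_inf.mpr ⟨Subgroup.mem_top _, a.2⟩
  have hb : b ∈ (((X.Iv PUnit.unit).subgroupOf X.PiI : Subgroup ↥X.PiI) : Set ↥X.PiI) := by
    show (b : X.PiH) ∈ X.Iv PUnit.unit
    rw [hIv]
    exact Subgroup.mem_top _
  -- the typed clause `D_v ∩ Π_I = Z_{Π_I}(I_v)` would make `a` central in `Π_I = 𝔖₃`
  rw [h3, Subgroup.mem_centralizer_iff] at ha
  have hab : Equiv.swap (1 : Fin 3) 2 * Equiv.swap (0 : Fin 3) 1 =
      Equiv.swap (0 : Fin 3) 1 * Equiv.swap (1 : Fin 3) 2 :=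
    congrArg Subtype.val (ha b hb)
  exact absurd hab (by decide)

/-- **F-0300, the schema is satisfiable** (degenerate witness: `Π_H = 1`, one vertex; every subgroup
of `Π_I = 1` is `1`).  Honest label: non-vacuity only — not the data of a stable log curve.
[cite: MochizukiAbsTopII2013, Prop 1.3 (v) p.12] -/
theorem exists_prop_1_3_v' :
    ∃ X : DPSCIndexData.{0},
      Literature.AnabelianGeometry.AbsoluteAnabelian.AbsTopII.DPSCIndexData.Prop_1_3_v' X := by
  let P : ProfiniteGrp.{0} := ProfiniteGrp.of PUnit.{1}
  let X : DPSCIndexData.{0} :=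
    { PiH := P, PiG := ⊥, normal_PiG := inferInstance, isClosed_PiG := isClosed_discrete _,
      PiI := ⊤, PiG_le_PiI := bot_le, normal_PiI := ⟨fun _ _ _ => Subgroup.mem_top _⟩,
      Vert := PUnit, Node := PEmpty, Cusp := PEmpty,
      vertSub := fun _ => ⊥, vertSub_le := fun _ => le_rfl,
      nodeSub := fun e => e.elim, nodeSub_le := fun e => e.elim,
      cuspSub := fun e => e.elim, cuspSub_le := fun e => e.elim,
      nodeAbuts := fun e _ => e.elim, cuspVert := fun e => e.elim,
      Sigma := {2},
      sigma_prime := ⟨Set.singleton_nonempty 2, fun p hp => by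
        rw [Set.mem_singleton_iff.mp hp]; exact Nat.prime_two⟩,
      sigmaIndex := fun e => e.elim, sigmaIndex_isSigmaInteger := fun e => e.elim }
  haveI hP : Subsingleton (↥X.PiI) :=
    inferInstanceAs (Subsingleton {x : PUnit.{1} // x ∈ (⊤ : Subgroup PUnit.{1})})
  exact ⟨X, fun v => ⟨Subsingleton.elim _ _, Subsingleton.elim _ _, Subsingleton.elim _ _,
    ⟨Subsingleton.elim _ _⟩⟩⟩

/-- **F-0300, kernel verdict on the schema row** `DPSCIndexData.Prop_1_3_v'`: universal closure
refuted, schema satisfiable — a genuine hypothesis on the DPSC data, consumable through the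
conditional proof `prop_1_3_v'_of_prop_1_3_iii'` (its printed inputs), never as a closed fact.
[cite: MochizukiAbsTopII2013, Prop 1.3 (v) p.12] -/
theorem prop_1_3_v'_schema_verdict :
    (¬ ∀ X : DPSCIndexData.{0},
        Literature.AnabelianGeometry.AbsoluteAnabelian.AbsTopII.DPSCIndexData.Prop_1_3_v' X) ∧
      ∃ X : DPSCIndexData.{0},
        Literature.AnabelianGeometry.AbsoluteAnabelian.AbsTopII.DPSCIndexData.Prop_1_3_v' X :=
  ⟨not_forall_prop_1_3_v', exists_prop_1_3_v'⟩

/-! ## F-0301: Prop 1.3 (x) (`Prop_1_3_x`) -/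

/-- **F-0301, universal closure REFUTED.**  `DPSCIndexData.Prop_1_3_x` does NOT hold for all
abstract DPSC index data: the label `LogPointData.kind` (the image of `τ_S` in `X`) is not tied to
the subgroup `τ_I(I)`.  Over `Π_H = 1` (`Π_𝔾 = 1`, `Π_I = Π_H`), two vertices `false ≠ true` with
`Π_v = 1`, no edges, and the log point `τ_I(I) = Π_I` labelled "smooth point of `true`": since the
image is not a cusp, the typed clause "`τ_I(I) = I_{false}` [some conjugate] `↔` the image is a
non-nodal point of `false`" has a true left side (all subgroups of `1` coincide) and a false right
side. [cite: MochizukiAbsTopII2013, Prop 1.3 (x) p.12] -/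
theorem not_forall_prop_1_3_x :
    ¬ ∀ X : DPSCIndexData.{0},
      Literature.AnabelianGeometry.AbsoluteAnabelian.AbsTopII.DPSCIndexData.Prop_1_3_x X := by
  intro h
  let P : ProfiniteGrp.{0} := ProfiniteGrp.of PUnit.{1}
  let X : DPSCIndexData.{0} :=
    { PiH := P, PiG := ⊥, normal_PiG := inferInstance, isClosed_PiG := isClosed_discrete _,
      PiI := ⊤, PiG_le_PiI := bot_le, normal_PiI := ⟨fun _ _ _ => Subgroup.mem_top _⟩,
      Vert := Bool, Node := PEmpty, Cusp := PEmpty,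
      vertSub := fun _ => ⊥, vertSub_le := fun _ => le_rfl,
      nodeSub := fun e => e.elim, nodeSub_le := fun e => e.elim,
      cuspSub := fun e => e.elim, cuspSub_le := fun e => e.elim,
      nodeAbuts := fun e _ => e.elim, cuspVert := fun e => e.elim,
      Sigma := {2},
      sigma_prime := ⟨Set.singleton_nonempty 2, fun p hp => by
        rw [Set.mem_singleton_iff.mp hp]; exact Nat.prime_two⟩,
      sigmaIndex := fun e => e.elim, sigmaIndex_isSigmaInteger := fun e => e.elim }
  haveI hP : Subsingleton X.PiH := inferInstanceAs (Subsingleton PUnit.{1})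
  -- the log point `τ_I(I) = Π_I` labelled "smooth point of the vertex `true`"
  let τ : X.LogPointData :=
    { image := ⊤, image_le := le_rfl, isClosed_image := isClosed_discrete _,
      image_inf := Subsingleton.elim _ _, image_sup := Subsingleton.elim _ _,
      kind := PointKind.smooth true }
  obtain ⟨-, h2⟩ := h X τ
  have key := ((h2 fun e => e.elim).1 false).mp ⟨1, Subsingleton.elim _ _⟩
  -- `key : PointKind.smooth true = PointKind.smooth false`
  cases key

/-- **F-0301, the schema is satisfiable** (degenerate witness: `Π_H = 1`, ONE vertex, no edges:
every log point is labelled by the unique vertex, `τ_I(I) = 1 = I_v`, and "non-verticial" is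
vacuously false).  Honest label: non-vacuity only.
[cite: MochizukiAbsTopII2013, Prop 1.3 (x) p.12] -/
theorem exists_prop_1_3_x :
    ∃ X : DPSCIndexData.{0},
      Literature.AnabelianGeometry.AbsoluteAnabelian.AbsTopII.DPSCIndexData.Prop_1_3_x X := by
  let P : ProfiniteGrp.{0} := ProfiniteGrp.of PUnit.{1}
  let X : DPSCIndexData.{0} :=
    { PiH := P, PiG := ⊥, normal_PiG := inferInstance, isClosed_PiG := isClosed_discrete _,
      PiI := ⊤, PiG_le_PiI := bot_le, normal_PiI := ⟨fun _ _ _ => Subgroup.mem_top _⟩,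
      Vert := PUnit, Node := PEmpty, Cusp := PEmpty,
      vertSub := fun _ => ⊥, vertSub_le := fun _ => le_rfl,
      nodeSub := fun e => e.elim, nodeSub_le := fun e => e.elim,
      cuspSub := fun e => e.elim, cuspSub_le := fun e => e.elim,
      nodeAbuts := fun e _ => e.elim, cuspVert := fun e => e.elim,
      Sigma := {2},
      sigma_prime := ⟨Set.singleton_nonempty 2, fun p hp => by
        rw [Set.mem_singleton_iff.mp hp]; exact Nat.prime_two⟩,
      sigmaIndex := fun e => e.elim, sigmaIndex_isSigmaInteger := fun e => e.elim }
  haveI hP : Subsingleton X.PiH := inferInstanceAs (Subsingleton PUnit.{1})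
  refine ⟨X, fun τ => ⟨fun hnv => ?_, fun _ => ⟨fun v => ?_, fun e => e.elim⟩⟩⟩
  · -- "non-verticial" is false: `τ_I(I) ≤ I_v` holds in the trivial group
    exact (hnv PUnit.unit 1 (le_of_eq (Subsingleton.elim _ _))).elim
  · -- every log point is labelled by the unique vertex, and `τ_I(I) = I_v` trivially
    obtain ⟨u⟩ := v
    refine ⟨fun _ => ?_, fun _ => ⟨1, Subsingleton.elim _ _⟩⟩
    rcases hk : τ.kind with e | w | e
    · exact e.elim
    · rfl
    · exact e.elim

/-- **F-0301, kernel verdict on the schema row** `DPSCIndexData.Prop_1_3_x`: universal closure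
refuted, schema satisfiable — a genuine hypothesis on the DPSC data (and, by abc-iut-L4-t6's
`not_prop_1_3_x_of_cusps_moved`, one whose conjugacy scope is still `Π_H`, wider than print's
`Π_𝔾`). [cite: MochizukiAbsTopII2013, Prop 1.3 (x) p.12] -/
theorem prop_1_3_x_schema_verdict :
    (¬ ∀ X : DPSCIndexData.{0},
        Literature.AnabelianGeometry.AbsoluteAnabelian.AbsTopII.DPSCIndexData.Prop_1_3_x X) ∧
      ∃ X : DPSCIndexData.{0},
        Literature.AnabelianGeometry.AbsoluteAnabelian.AbsTopII.DPSCIndexData.Prop_1_3_x X :=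
  ⟨not_forall_prop_1_3_x, exists_prop_1_3_x⟩

end Literature.AnabelianGeometry.AbsoluteAnabelian.AbsTopII.DPSCIndexData
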